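import Summits.NavierStokesRegularity.NavierStokesRegularity.Theorems.ScenarioCensusRowF1SnapshotTop
import HarnessLib

/-!
# LINE «snapshot-top» port, part 2/4: §3 MECHANISM — Leray's every-time floor and the PRESCRIBED-TIME (snapshot) zoom package; §4 one-slice kills in `𝒦_M` and the calm-pocket level

Re-homed for the scenario census (typer seat ns-census-typer-1 g9; the cells F1cs / F1ce / F1rs and the floors are members of row F1 «DECIDED IN KERNEL IN FILES» (item 75; ref
ns-census-ref g13 PRE-CHECK ✓ §18.16; critic PASS; lead label); this port makes them TREE-decided): VERBATIM PORT of ns-idea-3 LINE «snapshot-top»,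
`pub/ideators/ns-idea-3/lines/snapshot-top/line-snapshot-top.lean` sha16 5c984c2d30725568 (996 l., lean check rc 0, 0 sorry), split for the 400-line rule into
`ScenarioCensusRowF1SnapshotTop` (§1–§2) → `…SnapshotTopZoom` (§3–§4) → `…SnapshotTopRows` (§5) → `…SnapshotTopRigid` (§6–§7 + census KEYS).  Lean text VERBATIM in namespace
`…Theorems.ScenarioCensus.SnapshotTop` (the line's `…Cruxes.ScenarioCensusRowF1.SnapshotTopLine` re-homed); port edits: LINE 34's `topSet` (+ lemmas) and LINE 35's
`HasTypeIConstant` (+ lemmas), restated VERBATIM by the line, are taken BY NAME from the landed two-time-top / one-level-top ports; the second proof term `rowF1po_holds` is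
not re-declared; `@[conjecture]` on the residual `SnapshotCollapse` (≡ `ScenarioCensus.Row_F1`, OPEN); ten one-line docstrings added (gate lint).  Statements untouched.

No census VALUE is moved here (row F1 stays OPEN-WITH-LINE; the members become TREE-decided by name); NS regularity is NOT proved; `Row_F1` is untouched (zero
movement, `snapshotCollapse_iff_rowF1`); no summit statement is proved by this file.
-/

-- the summit and its single problem share the name `NavierStokesRegularity` (D-0017 nested layout)
set_option linter.dupNamespace false

noncomputable section

open MeasureTheory Set Function Filter TopologicalSpace Metric
open scoped Topology NNReal ENNReal

namespace Summit.NavierStokesRegularity.NavierStokesRegularity.Theorems.ScenarioCensus.SnapshotTop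

open Literature.Analysis Literature.Analysis.FluidPDE
open Summit.NavierStokesRegularity.NavierStokesRegularity.Theorems
open Summit.NavierStokesRegularity.NavierStokesRegularity.Theses

/-! ## §3 MECHANISM — Leray's EVERY-TIME floor and the PRESCRIBED-TIME (SNAPSHOT) ZOOM PACKAGE

LINE 35's package took its centres `(t_k, x_k)` where Leray's EVENTUAL rate happened to provide fast points; the times were not
ours to choose, so a hypothesis could be read along the zoom only if it held at ALL late times.  Leray's rate in fact holds at
EVERY instant of `[0, T)` (tree `leray_blowup_rate_top_holds`, with the sub-strip boundedness `eLpNorm_uncurry_top_lt_top_of_tao2011`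
exactly as in the tree's proof of `typeICertificateLadder_rungZero`), so the centres can be placed at ANY prescribed instants — in
particular inside any set of times that is hit frequently as `t ↑ T`.  The zoom then carries a SNAPSHOT hypothesis at the times
`t_k` to the single slice `s = −1` of the limit (values and gradients). -/

/-- **A `c_S`-fast point at EVERY instant** (Leray 1934 §19 (3.9), every-time form, Clay frame): if the classical Clay solution
does not extend past `T`, then at every `t ∈ [0, T)` some point has dimensionless speed `> c_S`. -/
theorem exists_fast_at {ν T : ℝ} (hν : 0 < ν) (hT : 0 < T) {u : ℝ → E3 → E3} {p : ℝ → E3 → ℝ}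
    (hsol : IsClassicalNSSolutionOn (Ico 0 T) ν 0 u p) (hLH : IsLerayHopfOn T ν 0 (u 0) u)
    (hdec : HasRapidSpatialDecay (u 0)) (hmax : ¬ HasSmoothExtensionPast ν 0 u T) {t : ℝ} (ht : t ∈ Ico 0 T) :
    ∃ x : E3, snapLevel * Real.sqrt ν < Real.sqrt (T - t) * ‖u t x‖ := by
  have hspec := Classical.choose_spec leray_blowup_rate_top_holds
  set c : ℝ := Classical.choose leray_blowup_rate_top_holds with hcdef
  have hc : 0 < c := hspec.1
  have hcS : snapLevel = c / 2 := rfl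
  by_contra hno
  push Not at hno
  have hM' : IsMaximalSmoothSolution ν 0 u p T := ⟨hsol, hmax⟩
  have hbdd : ∀ T' ∈ Ioo 0 T, eLpNorm (uncurry u) ∞
      ((volume : Measure (ℝ × E3)).restrict (Icc 0 T' ×ˢ univ)) < ∞ :=
    eLpNorm_uncurry_top_lt_top_of_tao2011 tao2011_hasBoundedSobolevNormsOn_holds hν hsol hLH hdec
  have hr := hspec.2 ν T hν hT u p hM' hLH hbdd t ht
  have hTt : 0 < T - t := sub_pos.2 ht.2
  have hsq : 0 < Real.sqrt (T - t) := Real.sqrt_pos.2 hTt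
  have hptw : ∀ x, ‖u t x‖ ≤ c / 2 * Real.sqrt ν / Real.sqrt (T - t) := by
    intro x
    rw [le_div_iff₀ hsq]
    have h := hno x
    rw [hcS] at h
    linarith [mul_comm (Real.sqrt (T - t)) ‖u t x‖]
  have h2 : eLpNorm (u t) ∞ volume ≤ ENNReal.ofReal (c / 2 * Real.sqrt ν / Real.sqrt (T - t)) := by
    rw [eLpNorm_exponent_top]
    exact eLpNormEssSup_le_of_ae_bound (Eventually.of_forall hptw)
  have hpos : 0 ≤ c / 2 * Real.sqrt ν / Real.sqrt (T - t) := by positivity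
  have h4 : c * Real.sqrt ν / Real.sqrt (T - t) ≤ c / 2 * Real.sqrt ν / Real.sqrt (T - t) :=
    (ENNReal.ofReal_le_ofReal_iff hpos).1 (hr.trans h2)
  have h5 := mul_le_mul_of_nonneg_right h4 hsq.le
  rw [div_mul_cancel₀ _ hsq.ne', div_mul_cancel₀ _ hsq.ne'] at h5
  have hK : 0 < c * Real.sqrt ν := mul_pos hc (Real.sqrt_pos.2 hν)
  linarith

/-- The parabolic unit: `√(ν · c²ν) = c ν` for `c, ν > 0`. -/
theorem sqrt_mul_sq_mul {ν c : ℝ} (hν : 0 < ν) (hc : 0 < c) : Real.sqrt (ν * (c ^ 2 * ν)) = c * ν := by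
  rw [show ν * (c ^ 2 * ν) = (c * ν) ^ 2 by ring, Real.sqrt_sq (mul_pos hc hν).le]

/-- **THE SNAPSHOT ZOOM PACKAGE (prescribed times).**  Let `u` be a classical Clay solution on `[0, T)` with dimensionless Type-I
constant `M` which does NOT extend past `T`, and let `Q` be any property of instants hit FREQUENTLY as `t ↑ T`.  Then there are
scales `c_j ↓ 0`, centres `x_j` and a member `W ∈ 𝒦_M` (SAME `M`) such that: the centre times `t_j = T − c_j²ν` all satisfy `Q`;
each `x_j` is `c_S`-fast at `t_j`; the zooms `c_j u(T + c_j²ν s, x_j + c_jν y)` converge to `W(s, y)` at every point of the open past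
together with their spatial gradients; and `‖W(−1, 0)‖ ≥ c_S`. -/
theorem exists_snapshotZoom_package {ν T M : ℝ} (hν : 0 < ν) (hT : 0 < T)
    {u : ℝ → E3 → E3} {p : ℝ → E3 → ℝ}
    (hsol : IsClassicalNSSolutionOn (Ico 0 T) ν 0 u p) (hLH : IsLerayHopfOn T ν 0 (u 0) u)
    (hdec : HasRapidSpatialDecay (u 0)) (hM : OneLevelTop.HasTypeIConstant ν T M u)
    (hmax : ¬ HasSmoothExtensionPast ν 0 u T) {Q : ℝ → Prop} (hQ : ∃ᶠ t in 𝓝[<] T, Q t) :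
    ∃ (c : ℕ → ℝ) (x : ℕ → E3) (W : ℝ → E3 → E3),
      (∀ j, 0 < c j) ∧ Tendsto c atTop (𝓝 0) ∧ IsTypeIAncientMild M W ∧
      (∀ j, Q (T + c j ^ 2 * ν * (-1))) ∧
      (∀ j, x j ∈ TwoTimeTop.topSet ν T u snapLevel (T + c j ^ 2 * ν * (-1))) ∧
      (∀ s < 0, ∀ y : E3,
        Tendsto (fun j => (c j * 1) • u (T + c j ^ 2 * ν * s) (x j + (c j * ν) • y)) atTop (𝓝 (W s y))) ∧
      (∀ s < 0, ∀ y : E3,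
        Tendsto (fun j => fderiv ℝ (fun y' : E3 => (c j * 1) • u (T + c j ^ 2 * ν * s) (x j + (c j * ν) • y')) y)
          atTop (𝓝 (fderiv ℝ (W s) y))) ∧
      snapLevel ≤ ‖W (-1) 0‖ := by
  -- ## (1) the rate window and the PRESCRIBED near-maximum sequence `(t_k, x_k)`: `Q t_k`, `T − t_k < δ/(k+2)`, `x_k` fast
  obtain ⟨δ, hδ, hδT, hrate⟩ := OneLevelTop.exists_window_of_hasTypeIConstant hT hM
  have hseq : ∀ k : ℕ, ∃ t : ℝ, ∃ x : E3, t ∈ Ioo (T - δ / ((k : ℝ) + 2)) T ∧ Q t ∧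
      snapLevel * Real.sqrt ν < Real.sqrt (T - t) * ‖u t x‖ := by
    intro k
    have hpos : 0 < δ / ((k : ℝ) + 2) := by positivity
    have hIoo : ∀ᶠ t in 𝓝[<] T, t ∈ Ioo (T - δ / ((k : ℝ) + 2)) T := Ioo_mem_nhdsLT (by linarith)
    have hIco : ∀ᶠ t in 𝓝[<] T, t ∈ Ico (0 : ℝ) T := Ico_mem_nhdsLT hT
    obtain ⟨t, hQt, htI, htIco⟩ := (hQ.and_eventually (hIoo.and hIco)).exists
    obtain ⟨x, hx⟩ := exists_fast_at hν hT hsol hLH hdec hmax htIco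
    exact ⟨t, x, htI, hQt, hx⟩
  choose t x htI hQt hfast using hseq
  have hTt : ∀ k, 0 < T - t k := fun k => sub_pos.2 (htI k).2
  have hTtδ : ∀ k, T - t k < δ / ((k : ℝ) + 2) := fun k => by linarith [(htI k).1]
  -- ## (2) scales `c_k = √((T − t_k)/ν)`: `c_k² ν = T − t_k`, `c_k → 0`
  set c : ℕ → ℝ := fun k => Real.sqrt ((T - t k) / ν) with hc
  have hcpos : ∀ k, 0 < c k := fun k => Real.sqrt_pos.2 (div_pos (hTt k) hν)
  have hc2 : ∀ k, c k ^ 2 * ν = T - t k := by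
    intro k
    simp only [hc]
    rw [Real.sq_sqrt (div_pos (hTt k) hν).le]
    field_simp
  have het : ∀ k, T + c k ^ 2 * ν * (-1) = t k := fun k => by rw [hc2 k]; ring
  have hclim : Tendsto c atTop (𝓝 0) := by
    have hk2 : Tendsto (fun k : ℕ => (k : ℝ) + 2) atTop atTop :=
      tendsto_atTop_add_const_right _ _ tendsto_natCast_atTop_atTop
    have hup0 : Tendsto (fun k : ℕ => δ / ((k : ℝ) + 2)) atTop (𝓝 0) := tendsto_const_nhds.div_atTop hk2
    have hupper : Tendsto (fun k : ℕ => δ / ((k : ℝ) + 2) / ν) atTop (𝓝 0) := by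
      simpa using hup0.div_const ν
    have h1 : Tendsto (fun k => (T - t k) / ν) atTop (𝓝 0) :=
      tendsto_of_tendsto_of_tendsto_of_le_of_le tendsto_const_nhds hupper
        (fun k => (div_pos (hTt k) hν).le) (fun k => div_le_div_of_nonneg_right (hTtδ k).le hν.le)
    have h2 := h1.sqrt
    rw [Real.sqrt_zero] at h2
    exact h2
  -- ## (3) the zooms and their windows `(A_k, 0)`, `A_k → −∞`
  have hα : (1 : ℝ) = ν / ν := (div_self hν.ne').symm
  have hβ : ν = ν ^ 2 / ν := by rw [sq, mul_div_cancel_right₀ _ hν.ne']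
  set w : ℕ → ℝ → E3 → E3 := fun k => (c k * 1) • stPull (c k ^ 2 * ν) (c k * ν) T (x k) u with hw
  set Aw : ℕ → ℝ := fun k => -(δ / (c k ^ 2 * ν)) with hA
  have hAwle : ∀ k, Aw k ≤ -((k : ℝ) + 2) := by
    intro k
    have hk : 0 < (k : ℝ) + 2 := by positivity
    have hprod : (T - t k) * ((k : ℝ) + 2) < δ := (lt_div_iff₀ hk).1 (hTtδ k)
    simp only [hA]
    rw [hc2 k, neg_le_neg_iff, le_div_iff₀ (hTt k)]
    linarith [mul_comm (T - t k) ((k : ℝ) + 2)]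
  have hAlim : Tendsto Aw atTop atBot := by
    have h1 : Tendsto (fun k : ℕ => -((k : ℝ) + 2)) atTop atBot :=
      tendsto_neg_atTop_atBot.comp (tendsto_atTop_add_const_right _ _ tendsto_natCast_atTop_atTop)
    exact tendsto_atBot_mono hAwle h1
  have hcW : ∀ k, ContinuousOn (uncurry (w k)) (Ioo (Aw k) 0 ×ˢ univ) := fun k =>
    zoom_continuousOn hν hsol hν hα hβ (hcpos k) hδT
  have hdivW : ∀ k, ∀ s ∈ Ioo (Aw k) 0, IsWeaklyDivFree (w k s) := fun k s hs =>
    zoom_isWeaklyDivFree hν hsol hν hα hβ (hcpos k) hδT hs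
  have hmildW : ∀ k, ∀ s s' : ℝ, Aw k < s → s < s' → s' < 0 → ∀ y,
      w k s' y = UnboundedOperators.heatExtension (w k s) (s' - s) y -
        oseenDuhamel 1 s (w k) (w k) s' y := fun k s s' hs hss' hs' y =>
    zoom_oseen hν hT hsol hLH hdec hν hα hβ (hcpos k) hδT hs hss' hs' y
  have hIW : ∀ k, ∀ s ∈ Ioo (Aw k) 0, ∀ y, ‖w k s y‖ ≤ M / Real.sqrt (-s) := by
    intro k s hs y
    have h : ‖w k s y‖ ≤ (1 * (M * Real.sqrt ν) / Real.sqrt ν) / Real.sqrt (-s) :=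
      zoom_norm_le (x₀ := x k) hν hα hβ hν (hcpos k) hδT hrate hs y
    have e : (1 : ℝ) * (M * Real.sqrt ν) / Real.sqrt ν = M := by
      rw [one_mul, mul_div_cancel_right₀ _ (Real.sqrt_pos.2 hν).ne']
    rw [e] at h
    exact h
  -- ## (4) extraction of a limit `W ∈ 𝒦_M` (SAME constant `M`), values and gradients
  obtain ⟨φ, hφ, W, hW, hpt, hgrad, -, -⟩ := exists_tendsto_of_typeI_seq_Ioo M hAlim hcW hdivW hmildW hIW
  have hφt : Tendsto φ atTop atTop := hφ.tendsto_atTop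
  -- ## (5) normalisation at `(−1, 0)`
  have hnorm : ∀ k, snapLevel ≤ ‖w k (-1) 0‖ := by
    intro k
    have e1 : w k (-1) 0 = (c k * 1) • u (T + c k ^ 2 * ν * (-1)) (x k + (c k * ν) • (0 : E3)) := by
      simp only [hw, smul_stPull_apply]
    rw [e1, smul_zero, add_zero, het, mul_one, norm_smul, Real.norm_eq_abs, abs_of_pos (hcpos k)]
    have hsq : Real.sqrt (T - t k) = c k * Real.sqrt ν := by
      rw [← hc2 k, Real.sqrt_mul (sq_nonneg _), Real.sqrt_sq (hcpos k).le]
    have h2 : snapLevel * Real.sqrt ν < c k * ‖u (t k) (x k)‖ * Real.sqrt ν := by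
      have h := hfast k
      rw [hsq] at h
      linarith [h, (by ring : c k * Real.sqrt ν * ‖u (t k) (x k)‖ = c k * ‖u (t k) (x k)‖ * Real.sqrt ν)]
    exact (lt_of_mul_lt_mul_right h2 (Real.sqrt_nonneg ν)).le
  have hge : snapLevel ≤ ‖W (-1) 0‖ :=
    ge_of_tendsto ((hpt (-1) (by norm_num) 0).norm) (Eventually.of_forall fun j => hnorm (φ j))
  -- ## (6) package along the subsequence
  have hwu : ∀ (k : ℕ) (s : ℝ),
      w k s = fun y => (c k * 1) • u (T + c k ^ 2 * ν * s) (x k + (c k * ν) • y) :=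
    fun k s => funext fun y => by simp only [hw, smul_stPull_apply]
  have hfastTop : ∀ k, x k ∈ TwoTimeTop.topSet ν T u snapLevel (T + c k ^ 2 * ν * (-1)) := by
    intro k
    rw [TwoTimeTop.mem_topSet, het]
    exact (hfast k).le
  refine ⟨fun j => c (φ j), fun j => x (φ j), W, fun j => hcpos _, hclim.comp hφt, hW,
    fun j => by rw [het]; exact hQt (φ j), fun j => hfastTop (φ j), fun s hs y => ?_, fun s hs y => ?_, hge⟩
  · exact (hpt s hs y).congr fun j => by rw [hwu]
  · exact (hgrad s hs y).congr fun j => by rw [hwu]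

/-! ## §4 ONE-SLICE KILLS in `𝒦_M` and the CALM-POCKET LEVEL

Every kill of this seat so far read the limit `W` on a space-time OPEN SET (a Liouville theorem, a time window, an event of
positive measure).  A snapshot hypothesis reaches only the slice `s = −1`.  Two exact kills live on one slice:
(K1) a slice of `W ∈ 𝒦_M` vanishing on a ball vanishes identically (real-analyticity of slices, tree
`IsTypeIAncientMild.analyticOnNhd_slice_univ`), contradicting the normalisation `‖W(−1, 0)‖ ≥ c_S` — no Liouville theorem, no
time window; (KC) ONE spatially CONSTANT slice kills the whole field (forward uniqueness of bounded Oseen-mild solutions, tree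
`oseenMild_bounded_unique`, continued to the whole past by time analyticity, tree `IsTypeIAncientMild.analyticAt_time`, and finished
by the tree's all-slices lemma `IsTypeIAncientMild.eq_zero_of_slice_const`) — used by the rigid-pocket instance of §6. -/

/-- **(K1) A slice vanishing on a ball vanishes.** -/
theorem slice_eq_zero_of_ball {M : ℝ} {W : ℝ → E3 → E3} (hW : IsTypeIAncientMild M W) {t : ℝ} (ht : t < 0)
    {z : E3} {r : ℝ} (hr : 0 < r) (h : ∀ y ∈ ball z r, W t y = 0) : ∀ y : E3, W t y = 0 := by
  have han : AnalyticOnNhd ℝ (W t) univ := hW.analyticOnNhd_slice_univ ht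
  have hz : ∀ᶠ y in 𝓝 z, W t y = 0 := by
    filter_upwards [ball_mem_nhds z hr] with y hy
    exact h y hy
  have hEq : EqOn (W t) 0 univ := han.eqOn_zero_of_preconnected_of_eventuallyEq_zero isPreconnected_univ (mem_univ z) hz
  intro y
  simpa using hEq (mem_univ y)

/-- **(KC) ONE CONSTANT SLICE KILLS.**  If the slice `W(−1, ·)` of `W ∈ 𝒦_M` is spatially constant, then `W ≡ 0` on the open past.
(Forward uniqueness on `(−1, −½)` against the constant solution — `e^{σΔ}a = a`, `B(a, a) = 0` —, time analyticity at each point,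
then the tree's all-slices lemma; the tree had only the all-slices version.) -/
theorem eq_zero_of_sliceConst {M : ℝ} {W : ℝ → E3 → E3} (hW : IsTypeIAncientMild M W) {a : E3}
    (h : ∀ y : E3, W (-1) y = a) : ∀ t < 0, ∀ y : E3, W t y = 0 := by
  -- ### (A) forward uniqueness on `(−1, −1/2)`: `W(t, ·) = a` a.e.
  have hWm1 : W (-1) = fun _ => a := funext h
  set M' : ℝ := max (M / Real.sqrt (-(-1 / 2 : ℝ))) ‖a‖ with hM'
  have hM'0 : 0 ≤ M' := le_max_of_le_right (norm_nonneg a)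
  have hhalf : (-1 / 2 : ℝ) < 0 := by norm_num
  have hae : ∀ t ∈ Ioo (-1 : ℝ) (-1 / 2), W t =ᵐ[volume] fun _ : E3 => a := by
    refine oseenMild_bounded_unique (E := E3) (ν := 1) (s := -1) (T := -1 / 2) (M := M')
      (U := fun _ _ => a) (u := W) (v := fun _ _ => a) one_pos hM'0 ?_ ?_ ?_ ?_ ?_ ?_
    · exact hW.aestronglyMeasurable_uncurry (s := -1) (T := -1 / 2) hhalf.le
    · exact aestronglyMeasurable_const
    · intro τ hτ y
      exact (hW.norm_le_of_mem_Ioo hhalf hτ y).trans (le_max_left _ _)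
    · intro τ _ y
      exact le_max_right _ _
    · intro t ht
      refine Eventually.of_forall fun x => ?_
      have hmild := hW.mild_eq_heatExtension (s := -1) (t := t) ht.1 (ht.2.trans hhalf) x
      rw [hmild, hWm1, UnboundedOperators.heatExtension_const a (by linarith [ht.1]) x]
    · intro t _
      refine Eventually.of_forall fun x => ?_
      have h0 : oseenDuhamel 1 (-1) (fun (_ : ℝ) (_ : E3) => a) (fun _ _ => a) t x = 0 :=
        oseenDuhamel_eq_zero_of_const (b := fun _ => a) (c := fun _ => a) (fun _ _ _ => rfl) (fun _ _ _ => rfl) x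
      simp [h0]
  -- ### (B) everywhere on `(−1, −1/2)` (continuity)
  have hev : ∀ t ∈ Ioo (-1 : ℝ) (-1 / 2), ∀ y : E3, W t y = a := by
    intro t ht y
    have hc : Continuous (W t) := hW.continuous_slice (ht.2.trans hhalf)
    have heq : W t = fun _ => a := (Continuous.ae_eq_iff_eq volume hc continuous_const).1 (hae t ht)
    rw [heq]
  -- ### (C) the whole past (time analyticity at each point)
  have hall : ∀ t < 0, ∀ y : E3, W t y = a := by
    intro t ht y
    have hg : AnalyticOnNhd ℝ (fun σ : ℝ => W σ y - a) (Iio 0) := fun σ hσ =>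
      (hW.analyticAt_time hσ y).sub analyticAt_const
    have hz : ∀ᶠ σ in 𝓝 (-3 / 4 : ℝ), W σ y - a = 0 := by
      filter_upwards [Ioo_mem_nhds (show (-1 : ℝ) < -3 / 4 by norm_num) (show (-3 / 4 : ℝ) < -1 / 2 by norm_num)]
        with σ hσ
      rw [hev σ hσ y, sub_self]
    have hEq : EqOn (fun σ : ℝ => W σ y - a) 0 (Iio 0) :=
      hg.eqOn_zero_of_preconnected_of_eventuallyEq_zero isPreconnected_Iio (show (-3 / 4 : ℝ) ∈ Iio 0 by norm_num) hz
    have h1 := hEq (mem_Iio.2 ht)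
    simp only [Pi.zero_apply, sub_eq_zero] at h1
    exact h1
  -- ### (D) the all-slices lemma of the tree
  intro t ht y
  exact hW.eq_zero_of_slice_const (b := fun _ => a) (fun s hs x => hall s hs x) ht y

/-- **Pockets pass to pointwise limits** (compactness of the pocket centres): if `f_j → g` pointwise, `‖f_j‖ ≤ b_j` on a closed
ball of radius `a` about a centre `ζ_j ∈ closedBall 0 A`, and `b_j → b₀`, then `‖g‖ ≤ b₀` on a closed ball of radius `a/2` about some
`ζ₀ ∈ closedBall 0 A`. -/
theorem pocket_limit {F : Type*} [NormedAddCommGroup F] {A a : ℝ} (ha : 0 < a) {ζ : ℕ → E3}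
    (hζ : ∀ j, ζ j ∈ closedBall (0 : E3) A)
    {f : ℕ → E3 → F} {g : E3 → F} {b : ℕ → ℝ} {b₀ : ℝ} (hb : Tendsto b atTop (𝓝 b₀))
    (hfg : ∀ y, Tendsto (fun j => f j y) atTop (𝓝 (g y))) (hf : ∀ j, ∀ y ∈ closedBall (ζ j) a, ‖f j y‖ ≤ b j) :
    ∃ ζ₀ ∈ closedBall (0 : E3) A, ∀ y ∈ closedBall ζ₀ (a / 2), ‖g y‖ ≤ b₀ := by
  obtain ⟨ζ₀, hζ₀, ψ, hψ, hlim⟩ := (isCompact_closedBall (0 : E3) A).tendsto_subseq hζ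
  refine ⟨ζ₀, hζ₀, fun y hy => ?_⟩
  have hev : ∀ᶠ j in atTop, dist ((ζ ∘ ψ) j) ζ₀ < a / 2 := (Metric.tendsto_nhds.1 hlim) (a / 2) (by positivity)
  have h1 : Tendsto (fun j => ‖f (ψ j) y‖) atTop (𝓝 ‖g y‖) := ((hfg y).comp hψ.tendsto_atTop).norm
  have h2 : Tendsto (fun j => b (ψ j)) atTop (𝓝 b₀) := hb.comp hψ.tendsto_atTop
  refine le_of_tendsto_of_tendsto h1 h2 ?_
  filter_upwards [hev] with j hj
  apply hf (ψ j) y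
  rw [mem_closedBall] at hy ⊢
  have := dist_triangle y ζ₀ (ζ (ψ j))
  simp only [Function.comp] at hj
  linarith [dist_comm ζ₀ (ζ (ψ j))]

/-- The **calm defect below `Λ`** of `W` on the slice `s = −1` (reach `A`, radius `a/2`): some closed ball of radius `a/2` centred
in `closedBall 0 A` on which `‖W(−1, ·)‖ ≤ Λ`. -/
def CalmDefectBelow (A a Λ : ℝ) (W : ℝ → E3 → E3) : Prop :=
  ∃ z ∈ closedBall (0 : E3) A, ∀ y ∈ closedBall z (a / 2), ‖W (-1) y‖ ≤ Λ

/-- **THE CALM-POCKET LEVEL `Λ₁(M, A, a, κ)`**: no `W ∈ 𝒦_M` with `‖W(−1, 0)‖ ≥ κ` has calm defect below `Λ₁` (socket + (K1)). -/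
theorem exists_calmLevel (M A a : ℝ) (ha : 0 < a) {κ : ℝ} (hκ : 0 < κ) :
    ∃ Λ₁ : ℝ, 0 < Λ₁ ∧ ∀ W : ℝ → E3 → E3, IsTypeIAncientMild M W → κ ≤ ‖W (-1) 0‖ →
      ¬ CalmDefectBelow A a Λ₁ W := by
  refine exists_level_of_limitKill M hκ (CalmDefectBelow A a) ?_
  intro Wn W ε hεpos hεlim hWn hW hP hpt _
  choose z hz hcalm using hP
  have ha2 : 0 < a / 2 := by positivity
  obtain ⟨ζ₀, -, hζ₀⟩ := pocket_limit ha2 hz hεlim (fun y => hpt (-1) (by norm_num) y) hcalm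
  have hball : ∀ y ∈ ball ζ₀ (a / 2 / 2), W (-1) y = 0 := by
    intro y hy
    have h0 : ‖W (-1) y‖ ≤ 0 := hζ₀ y (mem_closedBall.2 (mem_ball.1 hy).le)
    exact norm_le_zero_iff.1 h0
  exact slice_eq_zero_of_ball hW (by norm_num) (by positivity) hball 0

end Summit.NavierStokesRegularity.NavierStokesRegularity.Theorems.ScenarioCensus.SnapshotTop

end
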